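import Mathlib.GroupTheory.OrderOfElement
import Mathlib.Tactic.Module
import HarnessLib

/-!
# McCallum 1991, Prop. 4.4 «in particular» (`ord c_M(mℓ)_λ = ord c_M(m)_λ`) under (irr) — the KERNEL ROUTE, step (c):
# the order comparison is ONE LINE from Manin's relation `F² − a_ℓ F + ℓ = 0`
# (cell `bsd-stepL`, seat `bsd-stepL-corner-p1` g9; `--supports stmt-BirchSwinnertonDyer-19947`; memo HOME/corner/g9/CORNER-G9.md §3)

WHY. After g8/g9 the ONE corner-specific named input of `stub_kolyJ_max` (crux 19947) is McCallum's Prop. 4.4 «in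
particular» (= Jetchev Prop. 4.7, the walk's `h47` at every level and the swap's `h44c`), typed in the tree only under
TOWER surjectivity (`McCallum1991.prop44_localOrder_kolyvaginClass_mul_eq`), which is void on the non-surjective corner.
CORNER-G9 §3 records an image-free kernel route: with `D ⊂ Γ_K` the decomposition group at a prime over the Kolyvagin
prime `λ = (ℓ)` (which FIXES `T = E[p^M]`), reduction `red` at that prime (injective on `T`) and `F` the `ℓ`-power
Frobenius of `Ẽ_ℓ`: `red c_M(m)(D) = ⟨u⟩` with `u = (F² − 1)x` and `red c_M(mℓ)(D) = ⟨w⟩` with `w = ((ℓ+1)F − a_ℓ)x`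
for ONE `x ∈ Ẽ(𝔽̄_ℓ)` with `p^M x = red P_m` (Gross Prop. 3.7 (2), McCallum p. 302). THIS FILE is step (c), pure algebra
in any additive commutative group `A` with an injective additive `F` satisfying Manin's relation pointwise:
* `frob_apply_transverseValue_eq_smul`: `F((ℓ+1)•F x − a•x) = ℓ•(F(F x) − x)`;
* `addOrderOf_transverseValue_eq`: hence `ord((ℓ+1)•F x − a•x) = ord(F(F x) − x)` as soon as `ℓ` is prime to the
  latter order (here: a `p`-power, `p ≠ ℓ`).
Instantiation (later files): `A = Ẽ_ℓ(𝔽̄_ℓ)` (`geomPoints` of the reduction), `F = ` the action of an arithmetic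
Frobenius (`frobenius_sq_sub_trace_smul_add_card_smul`, Manin ∕ AEC V.2.3.1), `a = a_ℓ`.
HONEST FRAMING: two abstract lemmas; no definition ∕ fact ∕ sorry; nothing about any curve; no stub closes; T7.
References: [McCallumLMS1991] §4 Prop. 4.4 and its proof (p. 302: «(a_l − (l+1)Frob(l))/p^M · P_m»); [GrossLMS1991] §3
Prop. 3.7, §4; [Jetchev2008] Prop. 4.7 (arXiv), §4.2 item 4; [SilvermanAEC2009] Thm. V.2.3.1(b).
-/

set_option autoImplicit false
set_option linter.dupNamespace false

namespace Summit.BirchSwinnertonDyer.BirchSwinnertonDyer.Theorems.Prop44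

variable {A : Type*} [AddCommGroup A]

/-- **Manin's relation moves the transverse value onto the unramified one**: if `F(F z) − a•F z + ℓ•z = 0` for all
`z` (the Frobenius endomorphism of `Ẽ_ℓ`: `F² − a_ℓ F + ℓ = 0`), then for every `x`,
`F((ℓ+1)•F x − a•x) = ℓ•(F(F x) − x)` — i.e. `F·((ℓ+1)F − a) = ℓ(F² − 1)`, since
`(ℓ+1)F² − aF − ℓF² + ℓ = F² − aF + ℓ = 0`. In McCallum's proof of Prop. 4.4, `((ℓ+1)F − a_ℓ)x/p^M`-type points are
the reductions of the values of `c_M(mℓ)` on inertia and `(F² − 1)x` those of `c_M(m)` on Frobenius.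
[cite: McCallumLMS1991, §4 Prop. 4.4 proof (p. 302)] [cite: SilvermanAEC2009, Thm. V.2.3.1(b)] -/
theorem frob_apply_transverseValue_eq_smul (F : A →+ A) (a ℓ : ℤ) (hrel : ∀ z : A, F (F z) - a • F z + ℓ • z = 0)
    (x : A) : F ((ℓ + 1) • F x - a • x) = ℓ • (F (F x) - x) := by
  have h2 : F (F x) - a • F x + ℓ • x = 0 := hrel x
  rw [map_sub, map_zsmul, map_zsmul]
  calc (ℓ + 1) • F (F x) - a • F x = ℓ • (F (F x) - x) + (F (F x) - a • F x + ℓ • x) := by module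
    _ = ℓ • (F (F x) - x) := by rw [h2, add_zero]

/-- **`ord((ℓ+1)•F x − a•x) = ord(F(F x) − x)`** for an INJECTIVE additive `F` with Manin's relation
`F(F z) − a•F z + ℓ•z = 0`, whenever `ℓ` is prime to the order of `F(F x) − x` (a `p`-power at a Kolyvagin prime
`ℓ ≠ p`): `F` preserves orders, and so does multiplication by `ℓ` on an element of order prime to `ℓ`
(`Nat.Coprime.addOrderOf_nsmul`). This is the equality `ord c_M(mℓ)_λ = ord c_M(m)_λ` of McCallum's Prop. 4.4 read on the
reductions of the cocycle values (CORNER-G9 §3 (c)). [cite: McCallumLMS1991, §4 Prop. 4.4 «In particular» (p. 301)]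
[cite: Jetchev2008, Prop. 4.7] -/
theorem addOrderOf_transverseValue_eq (F : A →+ A) (hF : Function.Injective F) (a ℓ : ℤ)
    (hrel : ∀ z : A, F (F z) - a • F z + ℓ • z = 0) (x : A)
    (hcop : (addOrderOf (F (F x) - x)).Coprime ℓ.natAbs) :
    addOrderOf ((ℓ + 1) • F x - a • x) = addOrderOf (F (F x) - x) := by
  rw [← addOrderOf_injective F hF ((ℓ + 1) • F x - a • x), frob_apply_transverseValue_eq_smul F a ℓ hrel x]
  -- `ord (ℓ • u) = ord u` for `ℓ` prime to `ord u`
  set u := F (F x) - x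
  obtain ⟨n, hn | hn⟩ := Int.eq_nat_or_neg ℓ
  · rw [hn, natCast_zsmul]
    rw [hn, Int.natAbs_natCast] at hcop
    exact hcop.addOrderOf_nsmul
  · rw [hn, neg_zsmul, natCast_zsmul, addOrderOf_neg]
    rw [hn, Int.natAbs_neg, Int.natAbs_natCast] at hcop
    exact hcop.addOrderOf_nsmul

/-- **Vanishing form** (the `j = 0` case used by the swap's `h44c` and by Gross Prop. 6.2 (2)): under the same
hypotheses, `(ℓ+1)•F x − a•x = 0 ↔ F(F x) − x = 0`. [cite: McCallumLMS1991, §4 Prop. 4.4] [cite: GrossLMS1991, Prop. 6.2 (2)] -/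
theorem transverseValue_eq_zero_iff (F : A →+ A) (hF : Function.Injective F) (a ℓ : ℤ)
    (hrel : ∀ z : A, F (F z) - a • F z + ℓ • z = 0) (x : A)
    (hcop : (addOrderOf (F (F x) - x)).Coprime ℓ.natAbs) :
    (ℓ + 1) • F x - a • x = 0 ↔ F (F x) - x = 0 := by
  rw [← AddMonoid.addOrderOf_eq_one_iff, ← AddMonoid.addOrderOf_eq_one_iff,
    addOrderOf_transverseValue_eq F hF a ℓ hrel x hcop]

end Summit.BirchSwinnertonDyer.BirchSwinnertonDyer.Theorems.Prop44
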